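/-
Copyright (c) 2026 the pub-hodgecm-mathlib formalisation cell (harness21).  Prover seat hodgecm-mathlib-B-p14 (g30), (F11) «ramified torus `(EL)¹ × E¹`», sub-brick
(F1′-W) «the engine of Flicker's second decomposition `G = ⊔ H″ d_m K`» (architect A-p06 (g26) 04:34Z «go»; frame of B-p17 (g24)'s ★ (F1)), 2026-09-01.
Adapted from ★ `HyperspecialUnitaryIwasawa` §2–§3 (`exists_diagonal_isometry`, `exists_isometry_apply_single_eq`).
-/
import Literature.NumberTheory.Automorphic.HyperspecialUnitaryIwasawa   -- ★ `B₀`, `stdLattice`, `transvEquiv`, permutation ∕ diagonal isometries, `unitaryInt` glue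
import HarnessLib

/-!
# `K₀ = U(J₀)(𝒪)` is transitive on the primitive vectors of `𝒪^N` of a given NORM (Flicker 1998, Prop. 4, second decomposition, pp. 81–82)

Topic `NumberTheory/Automorphic`; namespace `Literature.NumberTheory.Automorphic.HermitianLattice`.  THEOREMS ONLY (no definition, no instance, no notation, no
named fact, no `sorry`).  Cell `pub/hodgecm-mathlib`, crux H413 = `stmt-HodgeConjecture-24833`, P3a road «D-N7-inert» (MAP v3, architect A-p06 (g26)), line
«N7nsCount», brick (F11) «ramified torus», sub-brick **(F1′-W)**: the ENGINE of Flicker's second double-coset decomposition `G = ⊔_{m ≥ 0} H″ d_m K`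
(`H″ = Stab_G(v₀)`, `v₀` an anisotropic vector with `⟨v₀, v₀⟩ = −π⁻¹`; proof p. 81–82: the sphere `S = {v : ⟨v,v⟩ = −π⁻¹} = ⊔_m v₀ d_m K` is stratified by the
sup-norm `‖v‖ = |π|^{−m−1}`, i.e. **`K` acts transitively on the vectors of `S` of a given sup-norm** — after rescaling by `π^{m+1}`: on the PRIMITIVE vectors of
`𝒪^N` of the given norm `a = −π^{2m+1}`).  Companion of ★ `exists_mem_unitaryInt_mulVec_single_eq` (the ISOTROPIC case, `a = 0`, used for Iwasawa); the
decomposition itself ((F1′), B-p17 (g24)) and the unfolding of `Φ′(t″)` ((F11-c)) consume this file.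

SETTING (★ `UnitaryAntidiagFrames` ∕ `HyperspecialUnitaryIwasawa`): `K` a field with `Valued K ℤᵐ⁰`, `σ : K →+* K` an involution preserving the valuation,
`J₀ = antidiag(1,…,1)`, `B₀ σ N x y = Σ σ(x_i) y_{rev i}`, `𝒪^N = stdLattice K N`, `K₀ = unitaryInt σ (J₀.over K)`, `e_l = Pi.single l 1`.
THE NORMAL FORM.  For `a ∈ K` `σ`-fixed and an index `i₀` with `rev i₀ ≠ i₀`, the vector `n(a) := e_{i₀} + (a∕2)·e_{rev i₀}` has `B₀ n(a) n(a) = a`.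
MAIN THEOREM **`exists_mem_unitaryInt_mulVec_normalForm_eq`**: if `|2| = 1`, `|a| ≤ 1`, and `v ∈ 𝒪^N` has `B₀ v v = a` and a unit coordinate at an index `j`
with `rev j ≠ j`, then `v = k · n(a)` for some `k ∈ K₀`.  PROOF (explicit, no Hensel): `u := v_j`; `c := a∕(2σu)`; the vector `x′ := u⁻¹(v − c e_{rev j})` has
`x′_j = 1` and is ISOTROPIC (`B₀(v, e_{rev j}) = σu`, `B₀(e_{rev j}, v) = u`, so `B₀ x′ x′ = (a − cσu − σ(c)u)∕(uσu) = 0`) and integral; the unitary transvection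
`T = transv j x′` (★) sends `e_j ↦ x′`, `e_{rev j} ↦ e_{rev j}`, hence `u e_j + (a∕(2σu)) e_{rev j} ↦ u x′ + c e_{rev j} = v`; the diagonal isometry
`D : e_j ↦ u e_j, e_{rev j} ↦ (σu)⁻¹ e_{rev j}` (§1, both values exported) and a `rev`-equivariant permutation `P : e_{i₀} ↦ e_j` give `T(D(P n(a))) = v`, and
`P, D, T` preserve `B₀` and `𝒪^N`, so their composite is (the matrix of) an element of `K₀` (★ `exists_unitary_toLin_eq`, ★ `mem_unitaryInt_of_map_stdLattice_eq`).
COROLLARIES: `exists_rev_ne_v_eq_one_of_v_B₀_lt_one` (a primitive integral vector of NON-UNIT norm has a unit coordinate off the `rev`-fixed index — else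
`B₀ v v ≡ N(v_m)` would be a unit), and the two-vector form **`exists_mem_unitaryInt_mulVec_eq_of_B₀_eq`** (`K₀`-TRANSITIVITY on primitive vectors of the
same non-unit norm).  HONEST LABEL: HC_CM is proved only modulo the printed citations until rung 0 closes; structure theory, pays nothing by itself.

## References
* [Flicker1998UnitaryFL] Y. Z. Flicker, *Elementary proof of the fundamental lemma for a unitary group*, Canad. J. Math. 50 (1998), Prop. 4 pp. 80–82 (the sphere `S`).
* [Omeara1963] O. T. O'Meara, *Introduction to Quadratic Forms* (1963), §82F (primitive vectors), §42D (transvections).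
* [Tits1979] J. Tits, *Reductive groups over local fields*, PSPUM 33.1 (1979), §3.3.3.
-/

set_option autoImplicit false

noncomputable section

open scoped Valued WithZero Matrix MatrixGroups

namespace Literature.NumberTheory.Automorphic.HermitianLattice

variable {K : Type*} [Field K] [Valued K ℤᵐ⁰] {σ : K →+* K} {N : ℕ}

/-! ## §1 The diagonal isometry with both values exported -/

/-- **The diagonal isometry `e_j ↦ u e_j`, `e_{rev j} ↦ σ(u)⁻¹ e_{rev j}`, `e_l ↦ e_l` otherwise** (`σ² = 1`, `rev j ≠ j`, `v(u) = 1`): a `B₀`-isometry of `K^N` mapping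
`𝒪^N` onto itself — ★ `exists_diagonal_isometry` with the value on `e_{rev j}` exported as well (adapted from it). [cite: Tits1979, §3.3.3] -/
theorem exists_diagonal_isometry₂ (hσ : ∀ a, σ (σ a) = a) (hvσ : ∀ a, Valued.v (σ a) = Valued.v a) {j : Fin N}
    (hj : Fin.rev j ≠ j) {u : K} (hu : Valued.v u = 1) :
    ∃ D : (Fin N → K) ≃ₗ[K] (Fin N → K), (∀ a b, B₀ σ N (D a) (D b) = B₀ σ N a b) ∧
      (stdLattice K N).map (D.toLinearMap.restrictScalars 𝒪[K]) = stdLattice K N ∧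
      D (Pi.single j 1) = u • Pi.single j 1 ∧ D (Pi.single (Fin.rev j) 1) = (σ u)⁻¹ • Pi.single (Fin.rev j) 1 ∧
      ∀ l, l ≠ j → l ≠ Fin.rev j → D (Pi.single l 1) = Pi.single l 1 := by
  have hu0 : u ≠ 0 := ne_zero_of_v_eq_one hu
  have hσu0 : σ u ≠ 0 := (map_ne_zero σ).2 hu0
  obtain ⟨d, hd⟩ : ∃ d : Fin N → K, d = fun l => if l = j then u else if l = Fin.rev j then (σ u)⁻¹ else 1 := ⟨_, rfl⟩
  obtain ⟨d', hd'⟩ : ∃ d' : Fin N → K, d' = fun l => if l = j then u⁻¹ else if l = Fin.rev j then σ u else 1 := ⟨_, rfl⟩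
  have hdj : d j = u := by rw [hd]; exact if_pos rfl
  have hdj' : d (Fin.rev j) = (σ u)⁻¹ := by rw [hd]; dsimp only; rw [if_neg hj, if_pos rfl]
  have hdl : ∀ l, l ≠ j → l ≠ Fin.rev j → d l = 1 := fun l h1 h2 => by rw [hd]; dsimp only; rw [if_neg h1, if_neg h2]
  have hd'j : d' j = u⁻¹ := by rw [hd']; exact if_pos rfl
  have hd'j' : d' (Fin.rev j) = σ u := by rw [hd']; dsimp only; rw [if_neg hj, if_pos rfl]
  have hd'l : ∀ l, l ≠ j → l ≠ Fin.rev j → d' l = 1 := fun l h1 h2 => by rw [hd']; dsimp only; rw [if_neg h1, if_neg h2]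
  have hdd' : ∀ l, d l * d' l = 1 := fun l => by
    by_cases h1 : l = j
    · rw [h1, hdj, hd'j, mul_inv_cancel₀ hu0]
    by_cases h2 : l = Fin.rev j
    · rw [h2, hdj', hd'j', inv_mul_cancel₀ hσu0]
    · rw [hdl l h1 h2, hd'l l h1 h2, mul_one]
  have hnorm : ∀ l, σ (d l) * d (Fin.rev l) = 1 := fun l => by
    by_cases h1 : l = j
    · rw [h1, hdj, hdj', mul_inv_cancel₀ hσu0]
    by_cases h2 : l = Fin.rev j
    · rw [h2, hdj', Fin.rev_rev, hdj, map_inv₀, hσ, inv_mul_cancel₀ hu0]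
    · have h3 : Fin.rev l ≠ j := fun h => h2 (by rw [← h, Fin.rev_rev])
      have h4 : Fin.rev l ≠ Fin.rev j := fun h => h1 (Fin.rev_injective h)
      rw [hdl l h1 h2, hdl _ h3 h4, map_one, mul_one]
  have hv1 : ∀ l, Valued.v (d l) = 1 := fun l => by
    by_cases h1 : l = j
    · rw [h1, hdj, hu]
    by_cases h2 : l = Fin.rev j
    · rw [h2, hdj', map_inv₀, hvσ, hu, inv_one]
    · rw [hdl l h1 h2, map_one]
  have hv1' : ∀ l, Valued.v (d' l) = 1 := fun l => by
    have h := congrArg Valued.v (hdd' l)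
    rw [map_mul, hv1, one_mul, map_one] at h
    exact h
  have h1 : (Matrix.toLin' (Matrix.diagonal d)).comp (Matrix.toLin' (Matrix.diagonal d')) = LinearMap.id := by
    rw [← Matrix.toLin'_mul, Matrix.diagonal_mul_diagonal, ← Matrix.toLin'_one, ← Matrix.diagonal_one]
    exact congrArg _ (congrArg _ (funext hdd'))
  have h2 : (Matrix.toLin' (Matrix.diagonal d')).comp (Matrix.toLin' (Matrix.diagonal d)) = LinearMap.id := by
    rw [← Matrix.toLin'_mul, Matrix.diagonal_mul_diagonal, ← Matrix.toLin'_one, ← Matrix.diagonal_one]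
    exact congrArg _ (congrArg _ (funext fun l => by rw [mul_comm]; exact hdd' l))
  refine ⟨LinearEquiv.ofLinear _ _ h1 h2, fun a b => ?_, ?_, ?_, ?_, fun l hl1 hl2 => ?_⟩
  · rw [LinearEquiv.ofLinear_apply, LinearEquiv.ofLinear_apply, Matrix.toLin'_apply, Matrix.toLin'_apply]
    exact B₀_diagonal_mulVec_of_norm hnorm a b
  · have hin : ∀ (c : Fin N → K), (∀ l, Valued.v (c l) = 1) → ∀ z ∈ stdLattice K N,
        (Matrix.diagonal c).mulVec z ∈ stdLattice K N := fun c hc z hz l => by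
      rw [Matrix.mulVec_diagonal, map_mul, hc, one_mul]; exact hz l
    apply le_antisymm
    · rintro _ ⟨z, hz, rfl⟩
      exact hin d hv1 z hz
    · intro z hz
      refine ⟨(Matrix.diagonal d').mulVec z, hin d' hv1' z hz, ?_⟩
      rw [LinearMap.coe_restrictScalars, LinearEquiv.coe_coe, LinearEquiv.ofLinear_apply, Matrix.toLin'_apply,
        Matrix.mulVec_mulVec, Matrix.diagonal_mul_diagonal,
        show (fun l => d l * d' l) = fun _ => (1 : K) from funext hdd', Matrix.diagonal_one, Matrix.one_mulVec]
  · rw [LinearEquiv.ofLinear_apply, Matrix.toLin'_apply, diagonal_mulVec_single_one, hdj]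
  · rw [LinearEquiv.ofLinear_apply, Matrix.toLin'_apply, diagonal_mulVec_single_one, hdj']
  · rw [LinearEquiv.ofLinear_apply, Matrix.toLin'_apply, diagonal_mulVec_single_one, hdl l hl1 hl2, one_smul]

/-! ## §2 The normal form and its norm -/

omit [Valued K ℤᵐ⁰] in
/-- **The normal form `n(a) = e_{i₀} + (a∕2) e_{rev i₀}` has norm `B₀ n(a) n(a) = a`** (`rev i₀ ≠ i₀`, `σ a = a`, `σ 2 = 2`, `2 ≠ 0`).
[cite: Flicker1998UnitaryFL, Prop. 4 p. 81 (`v₀ = (−1, 0, 1∕2π)`)] -/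
theorem B₀_normalForm_self (hσ2 : (2 : K) ≠ 0) {i₀ : Fin N} (hi₀ : Fin.rev i₀ ≠ i₀) {a : K} (hσa : σ a = a) :
    B₀ σ N (Pi.single i₀ 1 + (a / 2) • Pi.single (Fin.rev i₀) 1) (Pi.single i₀ 1 + (a / 2) • Pi.single (Fin.rev i₀) 1) = a := by
  simp only [map_add, map_smulₛₗ, LinearMap.add_apply, LinearMap.smul_apply, B₀_single_right,
    Pi.single_eq_same, Fin.rev_rev, Pi.single_eq_of_ne hi₀, Pi.single_eq_of_ne hi₀.symm,
    smul_eq_mul, map_one, map_zero, mul_zero, mul_one, add_zero, zero_add, map_div₀, hσa, map_ofNat, RingHom.id_apply]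
  field_simp
  ring

/-- **A primitive integral vector of NON-UNIT norm has a unit coordinate OFF the `rev`-fixed index**: if the only unit coordinate were the `rev`-fixed `v_m`,
`B₀ v v = σ(v_m) v_m + (terms of valuation < 1)` would be a unit. [cite: Omeara1963, §82F] [cite: Flicker1998UnitaryFL, p. 82] -/
theorem exists_rev_ne_v_eq_one_of_v_B₀_lt_one (hvσ : ∀ a, Valued.v (σ a) = Valued.v a) {v : Fin N → K}
    (hv : v ∈ stdLattice K N) (hunit : ∃ j, Valued.v (v j) = 1) (ha : Valued.v (B₀ σ N v v) < 1) :
    ∃ j, Fin.rev j ≠ j ∧ Valued.v (v j) = 1 := by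
  by_contra H
  push Not at H
  have hlt : ∀ i, Fin.rev i ≠ i → Valued.v (v i) < 1 := fun i hi => lt_of_le_of_ne (hv i) (H i hi)
  obtain ⟨m, hm⟩ := hunit
  have hmrev : Fin.rev m = m := by
    by_contra h
    exact H m h hm
  have hsplit : B₀ σ N v v = σ (v m) * v m + ∑ k ∈ Finset.univ.erase m, σ (v k) * v (Fin.rev k) := by
    rw [B₀_apply, ← Finset.add_sum_erase _ _ (Finset.mem_univ m), hmrev]
  have hsmall : Valued.v (∑ k ∈ Finset.univ.erase m, σ (v k) * v (Fin.rev k)) < 1 := by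
    refine Valuation.map_sum_lt _ one_ne_zero fun k hk => ?_
    have hkm : k ≠ m := (Finset.mem_erase.1 hk).1
    have hkrev : Fin.rev k ≠ k := fun h => hkm (Fin.eq_of_rev_eq_self h hmrev)
    rw [map_mul, hvσ]
    calc Valued.v (v k) * Valued.v (v (Fin.rev k)) ≤ Valued.v (v k) * 1 := mul_le_mul' le_rfl (hv _)
      _ < 1 := by rw [mul_one]; exact hlt k hkrev
  have hbig : Valued.v (σ (v m) * v m) = 1 := by rw [map_mul, hvσ, hm, one_mul]
  have h1 : Valued.v (B₀ σ N v v) = 1 := by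
    rw [hsplit, Valuation.map_add_eq_of_lt_left _ (by rw [hbig]; exact hsmall), hbig]
  exact (lt_irrefl _) (h1 ▸ ha)

/-! ## §3 `K₀` moves the normal form to any primitive vector of the same norm -/

/-- **MAIN THEOREM — `K₀` MOVES `n(a)` TO EVERY PRIMITIVE VECTOR OF NORM `a`.**  `σ` an involution preserving `v`, `|2| = 1`; `a ∈ K` with `σ a = a`, `|a| ≤ 1`;
`v ∈ 𝒪^N` with `B₀ v v = a` and a unit coordinate at some `j` with `rev j ≠ j`; `i₀` any index with `rev i₀ ≠ i₀`.  Then `v = k · (e_{i₀} + (a∕2) e_{rev i₀})` for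
some `k ∈ K₀ = U(J₀)(𝒪)` (permutation ∘ diagonal ∘ transvection, see the module docstring).  [cite: Flicker1998UnitaryFL, Prop. 4 pp. 81–82] [cite: Omeara1963, §82F] -/
theorem exists_mem_unitaryInt_mulVec_normalForm_eq (hσ : ∀ a, σ (σ a) = a) (hvσ : ∀ a, Valued.v (σ a) = Valued.v a)
    (h2 : Valued.v (2 : K) = 1) {a : K} (hσa : σ a = a) (ha : Valued.v a ≤ 1)
    {v : Fin N → K} (hvL : v ∈ stdLattice K N) {j : Fin N} (hj : Fin.rev j ≠ j) (hju : Valued.v (v j) = 1) (hvv : B₀ σ N v v = a)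
    {i₀ : Fin N} (hi₀ : Fin.rev i₀ ≠ i₀) :
    ∃ k : unitaryGroupOfForm σ ((StdForm.antidiagonal N).over K),
      k ∈ unitaryInt σ ((StdForm.antidiagonal N).over K) ∧
        ((k : GL (Fin N) K) : Matrix (Fin N) (Fin N) K).mulVec (Pi.single i₀ 1 + (a / 2) • Pi.single (Fin.rev i₀) 1) = v := by
  have h20 : (2 : K) ≠ 0 := ne_zero_of_v_eq_one h2
  have hσ2 : σ 2 = 2 := map_ofNat σ 2
  set u : K := v j with hudef
  have hu0 : u ≠ 0 := ne_zero_of_v_eq_one hju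
  have hσu0 : σ u ≠ 0 := (map_ne_zero σ).2 hu0
  -- the transvection vector `x′ = u⁻¹ (v − c e_{rev j})`, `c = a ∕ (2 σu)`
  obtain ⟨c, hcdef⟩ : ∃ c : K, c = a / (2 * σ u) := ⟨_, rfl⟩
  have hσc : σ c = a / (2 * u) := by rw [hcdef, map_div₀, hσa, map_mul, hσ2, hσ]
  obtain ⟨x', hx'⟩ : ∃ x' : Fin N → K, u⁻¹ • (v - c • Pi.single (Fin.rev j) 1) = x' := ⟨_, rfl⟩
  have hx'1 : x' j = 1 := by
    rw [← hx', Pi.smul_apply, Pi.sub_apply, Pi.smul_apply, Pi.single_eq_of_ne hj.symm, smul_zero, sub_zero, smul_eq_mul,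
      ← hudef, inv_mul_cancel₀ hu0]
  have hBve : B₀ σ N v (Pi.single (Fin.rev j) 1) = σ u := by rw [B₀_single_right, Fin.rev_rev]
  have hBev : B₀ σ N (Pi.single (Fin.rev j) 1) v = u := by rw [B₀_single_left, Fin.rev_rev]
  have hBee : B₀ σ N (Pi.single (Fin.rev j) 1 : Fin N → K) (Pi.single (Fin.rev j) 1) = 0 := by
    rw [B₀_single_left, Fin.rev_rev, Pi.single_eq_of_ne hj.symm]
  have hx'0 : B₀ σ N x' x' = 0 := by
    rw [← hx']
    simp only [map_smulₛₗ, map_sub, LinearMap.smul_apply, LinearMap.sub_apply, hvv, hBve, hBev, hBee, smul_eq_mul, hσc,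
      map_inv₀, mul_zero, sub_zero, RingHom.id_apply]
    rw [hcdef]
    field_simp
    ring
  have hcv : Valued.v c ≤ 1 := by
    rw [hcdef, map_div₀, map_mul, h2, hvσ, hju, one_mul, div_one]
    exact ha
  have hx'L : x' ∈ stdLattice K N := by
    rw [← hx']
    refine smul_mem_of_v_le _ (by rw [map_inv₀, hju, inv_one]) (Submodule.sub_mem _ hvL ?_)
    exact smul_mem_of_v_le _ hcv (single_mem_stdLattice _)
  -- the three isometries
  obtain ⟨τ, hτ, hτi₀, -⟩ := exists_perm_comm_rev_apply_eq hi₀ hj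
  obtain ⟨P, hPiso, hPL, hPe⟩ := exists_perm_isometry (K := K) (σ := σ) hτ
  obtain ⟨D, hDiso, hDL, hDj, hDj', -⟩ := exists_diagonal_isometry₂ (N := N) hσ hvσ hj hju
  have hτr : τ (Fin.rev i₀) = Fin.rev j := by rw [hτ, hτi₀]
  set ψ := P.trans (D.trans (transvEquiv hσ hj hx'1 hx'0)) with hψ
  have hψiso : ∀ x y, B₀ σ N (ψ x) (ψ y) = B₀ σ N x y := fun x y => by
    rw [hψ, LinearEquiv.trans_apply, LinearEquiv.trans_apply, LinearEquiv.trans_apply, LinearEquiv.trans_apply,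
      transvEquiv_apply, transvEquiv_apply, B₀_transv hσ hj hx'1 hx'0, hDiso, hPiso]
  have hψL : (stdLattice K N).map (ψ.toLinearMap.restrictScalars 𝒪[K]) = stdLattice K N := by
    rw [hψ, map_trans, map_trans, hPL, hDL]
    exact map_transvEquiv_stdLattice hσ hj hx'1 hx'0 hvσ hx'L
  have hψv : ψ (Pi.single i₀ 1 + (a / 2) • Pi.single (Fin.rev i₀) 1) = v := by
    rw [hψ, LinearEquiv.trans_apply, LinearEquiv.trans_apply, map_add, map_smul, hPe, hPe, hτi₀, hτr, map_add, map_smul, hDj, hDj',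
      map_add, map_smul, map_smul, map_smul, transvEquiv_apply, transvEquiv_apply, transv_single_self hj, transv_single_rev hj hx'1, ← hx',
      smul_smul, mul_inv_cancel₀ hu0, one_smul, smul_smul, sub_add, sub_eq_self, sub_eq_zero, hcdef]
    congr 1
    field_simp
  obtain ⟨k, hk⟩ := exists_unitary_toLin_eq (σ := σ) ψ hψiso
  refine ⟨k, mem_unitaryInt_of_map_stdLattice_eq (by rw [hk]; exact hψL), ?_⟩
  rw [← Matrix.toLin'_apply, hk, LinearEquiv.coe_coe, hψv]

/-- **`K₀` IS TRANSITIVE ON THE PRIMITIVE VECTORS OF `𝒪^N` OF A GIVEN NON-UNIT NORM** (two-vector form): `σ` an involution preserving `v`, `|2| = 1`; `v, v′ ∈ 𝒪^N`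
primitive (a unit coordinate each) with `B₀ v v = B₀ v′ v′ = a`, `σ a = a`, `|a| < 1`; then `v′ = k · v` for some `k ∈ K₀` (`N ≥ 2`).  This is the `K`-orbit
statement of Flicker's sphere stratification `S = ⊔_m v₀ d_m K` (p. 82) after rescaling.  [cite: Flicker1998UnitaryFL, Prop. 4 pp. 81–82] [cite: Omeara1963, §82F] -/
theorem exists_mem_unitaryInt_mulVec_eq_of_B₀_eq (hσ : ∀ a, σ (σ a) = a) (hvσ : ∀ a, Valued.v (σ a) = Valued.v a)
    (h2 : Valued.v (2 : K) = 1) {a : K} (hσa : σ a = a) (ha : Valued.v a < 1)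
    {v v' : Fin N → K} (hvL : v ∈ stdLattice K N) (hunit : ∃ j, Valued.v (v j) = 1) (hvv : B₀ σ N v v = a)
    (hv'L : v' ∈ stdLattice K N) (hunit' : ∃ j, Valued.v (v' j) = 1) (hv'v' : B₀ σ N v' v' = a) :
    ∃ k : unitaryGroupOfForm σ ((StdForm.antidiagonal N).over K),
      k ∈ unitaryInt σ ((StdForm.antidiagonal N).over K) ∧ ((k : GL (Fin N) K) : Matrix (Fin N) (Fin N) K).mulVec v = v' := by
  obtain ⟨j, hj, hju⟩ := exists_rev_ne_v_eq_one_of_v_B₀_lt_one hvσ hvL hunit (hvv ▸ ha)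
  obtain ⟨j', hj', hj'u⟩ := exists_rev_ne_v_eq_one_of_v_B₀_lt_one hvσ hv'L hunit' (hv'v' ▸ ha)
  obtain ⟨k, hk, hkv⟩ := exists_mem_unitaryInt_mulVec_normalForm_eq hσ hvσ h2 hσa ha.le hvL hj hju hvv hj
  obtain ⟨k', hk', hk'v⟩ := exists_mem_unitaryInt_mulVec_normalForm_eq hσ hvσ h2 hσa ha.le hv'L hj' hj'u hv'v' hj
  refine ⟨k' * k⁻¹, Subgroup.mul_mem _ hk' (Subgroup.inv_mem _ hk), ?_⟩
  have hkinv : (((k⁻¹ : unitaryGroupOfForm σ ((StdForm.antidiagonal N).over K)) : GL (Fin N) K) : Matrix (Fin N) (Fin N) K).mulVec v =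
      Pi.single j 1 + (a / 2) • Pi.single (Fin.rev j) 1 := by
    rw [← hkv, Matrix.mulVec_mulVec, Subgroup.coe_inv, ← Units.val_mul, inv_mul_cancel, Units.val_one, Matrix.one_mulVec]
  rw [Subgroup.coe_mul, Units.val_mul, ← Matrix.mulVec_mulVec, hkinv, hk'v]

end Literature.NumberTheory.Automorphic.HermitianLattice

end
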